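import Literature.MathematicalPhysics.QuantumLattice.GrassmannPolchinskiEquation
import Literature.MathematicalPhysics.QuantumLattice.GrassmannLaplacianTreeExpansion
import Literature.Probability.LatticeModels.CumulantRecursion
import Mathlib.Algebra.BigOperators.NatAntidiagonal
import HarnessLib

/-!
# The order-by-order renormalization group flow of the Grassmann truncated expectations
# (Salmhofer 1998, §3: the RGE at order `λ^r`), PROVED

Topic `MathematicalPhysics/QuantumLattice`; theorem-only companion (no definition, no named fact, no `sorry`)
of `GrassmannPolchinskiEquation.lean` (F7x: `HasCoeffDerivAt`, `hasCoeffDerivAt_gaussConv_apply` =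
Salmhofer's (Geffdif) `∂_t e^{Δ_{C_t}} F = Δ_{Ċ} e^{Δ_{C_t}} F`, `grassmannDerivPairing` = `(δa/δψ, C δb/δψ)_Γ`,
Prop. 1 = `hasCoeffDerivAt_salmhofer_rge`) and of the cumulant files of `Probability/LatticeModels`
(`cumulantOf`, `moment_succ_eq_sum_choose_mul_cumulantOf`).

**What is proved.**  M. Salmhofer, Commun. Math. Phys. 194 (1998) 249, §3.1–3.2: the effective action
`𝒢(t,ψ) = log ∫dμ_{C_t}(χ) e^{λV(χ+ψ)} = log e^{Δ_{C_t}} e^{λV}` (render p0011:L46-L60) is a formal power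
series `Σ_r λ^r 𝒢_r(t,ψ)` (p0011:L143-L150) and "(RGE) at order `λ^r`" (comparison of coefficients in
Prop. 1, p0012:L38-L54, L108) reads
`∂_t 𝒢_r = Δ_{Ċ_t} 𝒢_r + ½ Σ_{r₁+r₂=r} (δ𝒢_{r₁}/δψ, Ċ_t δ𝒢_{r₂}/δψ)_Γ`.
In the tree `e^{Δ_C} e^{λV} = Σ_k λ^k μ_k/k!`, `μ_k = e^{Δ_C} V^k ∈ ⋀^{even}`, and by the exponential formula
(`egf_eq_exp_subst_egfPos_cumulantOf`) `log Σ_k λ^k μ_k/k! = Σ_r λ^r κ_r/r!` with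
`κ_r = cumulantOf μ r = 𝓔ᵀ_C(V; r)` the truncated expectations (Benfatto–Giuliani–Mastropietro 2006,
(2.13)–(2.14); these are the objects of `kernel_effAction_eq_neg_tsum`), so `𝒢_r = κ_r/r!`.  We prove,
for an entrywise differentiable covariance with antisymmetric derivative `Ċ = C'` at `t` and any even `V`:

* `hasCoeffDerivAt_cumulant_flow` — `∂_t κ_N = Δ_{Ċ} κ_N + ½ Σ_{a+b=N} C(N,a) (δκ_a/δψ, Ċ δκ_b/δψ)`
  (coefficientwise, `HasCoeffDerivAt`), by strong induction on `N` over the moment–cumulant recursion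
  `μ_{n+1} = Σ_k C(n,k) κ_{k+1} μ_{n-k}` from the moment flow `∂_t μ_k = Δ_{Ċ} μ_k`
  (`hasCoeffDerivAt_coe_evenGaussConv`);
* `hasCoeffDerivAt_orderwise_effAction` — the same for `𝒢_r = κ_r/r!` in Salmhofer's form
  `∂_t 𝒢_r = Δ_{Ċ} 𝒢_r + ½ Σ_{r₁=1}^{r-1} (δ𝒢_{r₁}/δψ, Ċ δ𝒢_{r-r₁}/δψ)`, i.e. exactly the hypothesis `hflow` of
  `FermiRG.Salmhofer1998.isRGESolution_of_orderwise_rge` (`Salmhofer1998ComponentRGE.lean`).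

Ingredients (§1): the Leibniz defect of the Laplacian along an even factor,
`Δ_C(ab) = (Δ_C a) b + a (Δ_C b) + (δa/δψ, C δb/δψ)` for `a` even and `C` antisymmetric
(`grassmannLaplacian_mul_of_mem_evenOdd_zero`; the computation "performing the derivatives with respect
to `ψ`" of the proof of Prop. 1), whence the pairing is symmetric on even elements
(`grassmannDerivPairing_comm_of_mem_evenOdd_zero`) and a derivation in each slot along even factors
(`grassmannDerivPairing_mul_right_of_mem_evenOdd_zero`).  §2 is pure commutative algebra (private): a
derivation passes through the moment–cumulant recursion as `δM = (δK)M` (`M = exp K`), and the resulting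
identity `2 Σ_k C(n,k) B(κ_{k+1}, μ_{n-k}) = Σ_k C(n,k) Q₂(k+1) μ_{n-k}`, `Q₂(N) = Σ_a C(N,a) B(κ_a, κ_{N-a})`,
for a symmetric biderivation `B` (the coefficient form of `𝒫(K',M) = ½ 𝒫(K,K)' M`), via two trinomial
re-associations of binomially weighted double sums.

Design.  (i) The print derives the order-`r` equation by comparing coefficients of `λ^r` in (RGE) for the
formal power series `𝒢(t,ψ)`; the tree's Prop. 1 (`hasCoeffDerivAt_effAction_flow`) is stated at a fixed
numerical coupling with `Z_t ≠ 0`, so instead of a joint `(λ,t)`-regularity argument we differentiate the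
λ-coefficients `κ_r/r!` directly — the same identity, organised through the cumulant recursion (Ruelle 1969,
(4.5)–(4.7)).  (ii) `Ċ` antisymmetric is assumed (true for fermionic covariance families, and derived from
the antisymmetry of `C_∞ - C_t` in the FermiRG companion); it makes the cross term of the Leibniz defect
exactly `(δa/δψ, Ċ δb/δψ)`.  (iii) `𝒢_0 := 0` (the `λ^0` term `log Z` is field independent and plays no role
in the component RGE).  Everything is over `RCLike 𝕜`, time in a nontrivially normed field `𝕂`, as in F7x.

## References

M. Salmhofer, Commun. Math. Phys. 194 (1998) 249–295, §3.1–3.2 (`Salmhofer1998`; render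
`paper-arxiv-cond-mat_9706188` p0011–p0012); G. Benfatto, A. Giuliani, V. Mastropietro, Ann. Henri
Poincaré 7 (2006) 809, (2.13)–(2.14) (`BenfattoGiulianiMastropietro2006`); D. Ruelle, *Statistical
Mechanics* (1969), §4.4.1 (4.5)–(4.7) (`Ruelle1969`).
-/

noncomputable section

namespace Literature.MathematicalPhysics.QuantumLattice

open GrassmannAlgebra Finset
open scoped Nat

/-! ## §1 The pairing `(δa/δψ, C δb/δψ)` against even elements -/

section PairingAlgebra

variable (R : Type*) [CommRing R] {Γ : Type*} [Fintype Γ]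

/-- Additivity of the pairing in the right slot. [folklore] -/
private theorem grassmannDerivPairing_add_right (C : Matrix Γ Γ R) (a b c : GrassmannAlgebra R Γ) :
    grassmannDerivPairing R C a (b + c) = grassmannDerivPairing R C a b + grassmannDerivPairing R C a c := by
  simp only [grassmannDerivPairing_apply, map_add, mul_add, smul_add, sum_add_distrib]

/-- Homogeneity of the pairing in the right slot. [folklore] -/
private theorem grassmannDerivPairing_smul_right (C : Matrix Γ Γ R) (r : R) (a b : GrassmannAlgebra R Γ) :
    grassmannDerivPairing R C a (r • b) = r • grassmannDerivPairing R C a b := by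
  simp only [grassmannDerivPairing_apply, map_smul, mul_smul_comm, Finset.smul_sum]
  exact sum_congr rfl fun X _ => sum_congr rfl fun Y _ => smul_comm _ _ _

/-- Homogeneity of the pairing in the left slot. [folklore] -/
private theorem grassmannDerivPairing_smul_left (C : Matrix Γ Γ R) (r : R) (a b : GrassmannAlgebra R Γ) :
    grassmannDerivPairing R C (r • a) b = r • grassmannDerivPairing R C a b := by
  simp only [grassmannDerivPairing_apply, map_smul, smul_mul_assoc, Finset.smul_sum]
  exact sum_congr rfl fun X _ => sum_congr rfl fun Y _ => smul_comm _ _ _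

/-- The pairing vanishes on `0` in the right slot. [folklore] -/
private theorem grassmannDerivPairing_zero_right (C : Matrix Γ Γ R) (a : GrassmannAlgebra R Γ) :
    grassmannDerivPairing R C a 0 = 0 := by
  simp only [grassmannDerivPairing_apply, map_zero, mul_zero, smul_zero, sum_const_zero]

/-- The pairing vanishes on `0` in the left slot. [folklore] -/
private theorem grassmannDerivPairing_zero_left (C : Matrix Γ Γ R) (b : GrassmannAlgebra R Γ) :
    grassmannDerivPairing R C 0 b = 0 := by
  simp only [grassmannDerivPairing_apply, map_zero, zero_mul, smul_zero, sum_const_zero]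

/-- The pairing against a scalar vanishes. [folklore] -/
private theorem grassmannDerivPairing_one_right (C : Matrix Γ Γ R) (a : GrassmannAlgebra R Γ) :
    grassmannDerivPairing R C a 1 = 0 := by
  simp only [grassmannDerivPairing_apply, grassmannDeriv_one, mul_zero, smul_zero, sum_const_zero]

/-- **The right slot of the pairing is a derivation along even factors**:
`(δa/δψ, C δ(bc)/δψ) = (δa/δψ, C δb/δψ) c + b (δa/δψ, C δc/δψ)` for `b` even (Leibniz rule for the even
factor `b`, which is central). [cite: Salmhofer1998, §3.1 Prop. 1 proof (p.11; render p0011:L133-L139)] -/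
theorem grassmannDerivPairing_mul_right_of_mem_evenOdd_zero (C : Matrix Γ Γ R) (a : GrassmannAlgebra R Γ)
    {b : GrassmannAlgebra R Γ} (hb : b ∈ evenOdd R 0) (c : GrassmannAlgebra R Γ) :
    grassmannDerivPairing R C a (b * c) =
      grassmannDerivPairing R C a b * c + b * grassmannDerivPairing R C a c := by
  simp only [grassmannDerivPairing_apply, Finset.sum_mul, Finset.mul_sum, smul_mul_assoc, mul_smul_comm,
    ← sum_add_distrib, ← smul_add]
  refine sum_congr rfl fun X _ => sum_congr rfl fun Y _ => ?_
  rw [grassmannDeriv_mul_of_mem_evenOdd_zero R Y hb c, mul_add, ← mul_assoc, ← mul_assoc,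
    ← (commute_of_mem_evenOdd_zero R hb (grassmannDeriv R X a)).eq, mul_assoc b]

/-- The pairing of two even elements is even (so the bilinear term of (RGE) stays in the even
subalgebra, Prop. 1). [cite: Salmhofer1998, §3.1 Prop. 1 (RGE) (render p0011:L82-L93)] -/
theorem grassmannDerivPairing_mem_evenOdd_zero (C : Matrix Γ Γ R) {a b : GrassmannAlgebra R Γ}
    (ha : a ∈ evenOdd R 0) (hb : b ∈ evenOdd R 0) : grassmannDerivPairing R C a b ∈ evenOdd R 0 := by
  rw [grassmannDerivPairing_apply]
  refine Submodule.sum_mem _ fun X _ => Submodule.sum_mem _ fun Y _ => Submodule.smul_mem _ _ ?_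
  have h := SetLike.mul_mem_graded (grassmannDeriv_mem_evenOdd R X ha) (grassmannDeriv_mem_evenOdd R Y hb)
  rwa [show ((0 : ZMod 2) + 1) + ((0 : ZMod 2) + 1) = 0 from by decide] at h

variable [Algebra ℚ R]

/-- **Leibniz defect of the Laplacian along an even factor**: for `a` even and an antisymmetric
covariance `C`, `Δ_C (ab) = (Δ_C a) b + a (Δ_C b) + (δa/δψ, C δb/δψ)` ("performing the derivatives
with respect to `ψ`" in the proof of Prop. 1: the cross terms of the two fermionic derivatives).
[cite: Salmhofer1998, §3.1 Prop. 1 proof (p.11; render p0011:L133-L139)] -/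
theorem grassmannLaplacian_mul_of_mem_evenOdd_zero (C : Matrix Γ Γ R) (hC : C.transpose = -C)
    {a : GrassmannAlgebra R Γ} (ha : a ∈ evenOdd R 0) (b : GrassmannAlgebra R Γ) :
    grassmannLaplacian R C (a * b) =
      grassmannLaplacian R C a * b + a * grassmannLaplacian R C b + grassmannDerivPairing R C a b := by
  have hCt : ∀ X Y, C Y X = -C X Y := fun X Y => by
    have h := congrFun (congrFun hC X) Y
    rwa [Matrix.transpose_apply, Matrix.neg_apply] at h
  have hodd : ∀ Y, grassmannDeriv R Y a ∈ evenOdd R 1 := fun Y => by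
    have h := grassmannDeriv_mem_evenOdd R Y ha
    rwa [zero_add] at h
  have hXY : ∀ X Y, grassmannDeriv R X (grassmannDeriv R Y (a * b)) =
      grassmannDeriv R X (grassmannDeriv R Y a) * b + a * grassmannDeriv R X (grassmannDeriv R Y b) +
        (grassmannDeriv R X a * grassmannDeriv R Y b - grassmannDeriv R Y a * grassmannDeriv R X b) := by
    intro X Y
    rw [grassmannDeriv_mul_of_mem_evenOdd_zero R Y ha b, map_add, grassmannDeriv_mul,
      CliffordAlgebra.involute_eq_of_mem_odd (hodd Y), grassmannDeriv_mul_of_mem_evenOdd_zero R X ha, neg_mul]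
    abel
  have hT : ∑ X, ∑ Y, C X Y • (grassmannDeriv R Y a * grassmannDeriv R X b) =
      -∑ X, ∑ Y, C X Y • (grassmannDeriv R X a * grassmannDeriv R Y b) := by
    rw [Finset.sum_comm]
    simp only [← Finset.sum_neg_distrib]
    exact sum_congr rfl fun U _ => sum_congr rfl fun V _ => by rw [hCt U V, neg_smul]
  rw [grassmannLaplacian_apply, grassmannLaplacian_apply, grassmannLaplacian_apply, grassmannDerivPairing_apply]
  set P := ∑ X, ∑ Y, C X Y • (grassmannDeriv R X a * grassmannDeriv R Y b) with hP
  have hsum : ∑ X, ∑ Y, C X Y • grassmannDeriv R X (grassmannDeriv R Y (a * b)) =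
      (∑ X, ∑ Y, C X Y • grassmannDeriv R X (grassmannDeriv R Y a)) * b +
        a * (∑ X, ∑ Y, C X Y • grassmannDeriv R X (grassmannDeriv R Y b)) + (P + P) := by
    simp_rw [hXY, smul_add, smul_sub, sum_add_distrib, sum_sub_distrib]
    rw [hT, sub_neg_eq_add, hP]
    congr 1
    congr 1
    · rw [Finset.sum_mul]
      refine sum_congr rfl fun X _ => ?_
      rw [Finset.sum_mul]
      exact sum_congr rfl fun Y _ => (smul_mul_assoc _ _ _).symm
    · rw [Finset.mul_sum]
      refine sum_congr rfl fun X _ => ?_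
      rw [Finset.mul_sum]
      exact sum_congr rfl fun Y _ => (mul_smul_comm _ _ _).symm
  have e3 : ((1 / 2 : ℚ) • (1 : R)) • (P + P) = P := by
    rw [← two_smul ℚ P, smul_one_smul, smul_smul]
    norm_num
  rw [hsum, smul_add, smul_add, ← smul_mul_assoc, ← mul_smul_comm, e3]

/-- **The pairing is symmetric on even elements** (for an antisymmetric covariance): from
`Δ_C (ab) = Δ_C (ba)` and the Leibniz defect. [cite: Salmhofer1998, §3.1 Prop. 1 proof (p.11; render p0011:L133-L139)] -/
theorem grassmannDerivPairing_comm_of_mem_evenOdd_zero (C : Matrix Γ Γ R) (hC : C.transpose = -C)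
    {a b : GrassmannAlgebra R Γ} (ha : a ∈ evenOdd R 0) (hb : b ∈ evenOdd R 0) :
    grassmannDerivPairing R C a b = grassmannDerivPairing R C b a := by
  have h1 := grassmannLaplacian_mul_of_mem_evenOdd_zero R C hC ha b
  have h2 := grassmannLaplacian_mul_of_mem_evenOdd_zero R C hC hb a
  rw [(commute_of_mem_evenOdd_zero R ha b).eq, h2,
    (commute_of_mem_evenOdd_zero R (grassmannLaplacian_mem_evenOdd R C ha) b).eq.symm,
    (commute_of_mem_evenOdd_zero R ha (grassmannLaplacian R C b)).eq, add_comm (grassmannLaplacian R C b * a)] at h1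
  exact (add_left_cancel h1).symm

end PairingAlgebra

/-! ## §2 The cumulant recursion against a symmetric biderivation (commutative ring) -/

section CumulantAlgebra

variable {S : Type*} [CommRing S]

/-- Trinomial re-association of a binomially weighted double sum, grouping by the last index:
`Σ_{k+m=n} Σ_{a+b=m} C(n,k) C(m,a) F(k,a,b) = Σ_{j+b=n} Σ_{k+a=j} C(n,j) C(j,k) F(k,a,b)`. [folklore] -/
private theorem sum_antidiagonal_choose_assoc {M : Type*} [AddCommMonoid M] (F : ℕ → ℕ → ℕ → M) (n : ℕ) :
    ∑ p ∈ antidiagonal n, ∑ q ∈ antidiagonal p.2, (n.choose p.1 * p.2.choose q.1) • F p.1 q.1 q.2 =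
      ∑ p ∈ antidiagonal n, ∑ q ∈ antidiagonal p.1, (n.choose p.1 * p.1.choose q.1) • F q.1 q.2 p.2 := by
  rw [sum_sigma', sum_sigma']
  refine sum_nbij' (fun x => ⟨(x.1.1 + x.2.1, x.2.2), (x.1.1, x.2.1)⟩)
    (fun y => ⟨(y.2.1, y.2.2 + y.1.2), (y.2.2, y.1.2)⟩) ?_ ?_ ?_ ?_ ?_
  · rintro ⟨⟨k, m⟩, ⟨a, b⟩⟩ h
    simp only [mem_sigma, HasAntidiagonal.mem_antidiagonal, and_true] at h ⊢
    omega
  · rintro ⟨⟨j, b⟩, ⟨k, a⟩⟩ h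
    simp only [mem_sigma, HasAntidiagonal.mem_antidiagonal, and_true] at h ⊢
    omega
  · rintro ⟨⟨k, m⟩, ⟨a, b⟩⟩ h
    simp only [mem_sigma, HasAntidiagonal.mem_antidiagonal] at h
    obtain ⟨-, rfl⟩ := h
    rfl
  · rintro ⟨⟨j, b⟩, ⟨k, a⟩⟩ h
    simp only [mem_sigma, HasAntidiagonal.mem_antidiagonal] at h
    obtain ⟨-, rfl⟩ := h
    rfl
  · rintro ⟨⟨k, m⟩, ⟨a, b⟩⟩ h
    simp only [mem_sigma, HasAntidiagonal.mem_antidiagonal] at h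
    obtain ⟨hkm, rfl⟩ := h
    dsimp only
    rw [Nat.choose_mul (n := n) (k := k + a) (s := k) (by omega), show n - k = a + b by omega,
      Nat.add_sub_cancel_left]

/-- The same, grouping by the middle index:
`Σ_{k+m=n} Σ_{a+b=m} C(n,k) C(m,a) F(k,a,b) = Σ_{a+r=n} Σ_{k+b=r} C(n,a) C(r,k) F(k,a,b)`. [folklore] -/
private theorem sum_antidiagonal_choose_middle {M : Type*} [AddCommMonoid M] (F : ℕ → ℕ → ℕ → M) (n : ℕ) :
    ∑ p ∈ antidiagonal n, ∑ q ∈ antidiagonal p.2, (n.choose p.1 * p.2.choose q.1) • F p.1 q.1 q.2 =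
      ∑ p ∈ antidiagonal n, ∑ q ∈ antidiagonal p.2, (n.choose p.1 * p.2.choose q.1) • F q.1 p.1 q.2 := by
  rw [sum_sigma', sum_sigma']
  refine sum_nbij' (fun x => ⟨(x.2.1, x.1.1 + x.2.2), (x.1.1, x.2.2)⟩)
    (fun x => ⟨(x.2.1, x.1.1 + x.2.2), (x.1.1, x.2.2)⟩) ?_ ?_ ?_ ?_ ?_
  · rintro ⟨⟨k, m⟩, ⟨a, b⟩⟩ h
    simp only [mem_sigma, HasAntidiagonal.mem_antidiagonal, and_true] at h ⊢
    omega
  · rintro ⟨⟨k, m⟩, ⟨a, b⟩⟩ h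
    simp only [mem_sigma, HasAntidiagonal.mem_antidiagonal, and_true] at h ⊢
    omega
  · rintro ⟨⟨k, m⟩, ⟨a, b⟩⟩ h
    simp only [mem_sigma, HasAntidiagonal.mem_antidiagonal] at h
    obtain ⟨-, rfl⟩ := h
    rfl
  · rintro ⟨⟨k, m⟩, ⟨a, b⟩⟩ h
    simp only [mem_sigma, HasAntidiagonal.mem_antidiagonal] at h
    obtain ⟨-, rfl⟩ := h
    rfl
  · rintro ⟨⟨k, m⟩, ⟨a, b⟩⟩ h
    simp only [mem_sigma, HasAntidiagonal.mem_antidiagonal] at h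
    obtain ⟨hkm, rfl⟩ := h
    dsimp only
    congr 1
    have e1 : n.choose (k + a) * (k + a).choose k = n.choose k * (a + b).choose a := by
      rw [Nat.choose_mul (n := n) (k := k + a) (s := k) (by omega), show n - k = a + b by omega,
        Nat.add_sub_cancel_left]
    have e2 : n.choose (k + a) * (k + a).choose a = n.choose a * (k + b).choose k := by
      rw [Nat.choose_mul (n := n) (k := k + a) (s := a) (by omega), show n - a = k + b by omega,
        Nat.add_sub_cancel]
    rw [← e1, Nat.choose_symm_add, e2]

/-- **A derivation passes through the moment–cumulant recursion as through an exponential**: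
if every `B x` is a derivation (`B x (yz) = (B x y) z + y (B x z)`) and `μ`, `κ` satisfy the
moment–cumulant recursion `μ_{n+1} = Σ_{k+m=n} C(n,k) κ_{k+1} μ_m` with `μ_0 = 1`, `κ_0 = 0`, then
`B x μ_N = Σ_{a+b=N} C(N,a) (B x κ_a) μ_b` — the coefficient form of `δM = (δK) M` for `M = exp K`.
[folklore] -/
private theorem map_moment_eq_sum_of_derivation (B : S → S →+ S)
    (hder : ∀ x y z, B x (y * z) = B x y * z + y * B x z) (μ κ : ℕ → S) (hμ0 : μ 0 = 1) (hκ0 : κ 0 = 0)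
    (hrec : ∀ n, μ (n + 1) = ∑ p ∈ antidiagonal n, n.choose p.1 • (κ (p.1 + 1) * μ p.2)) (x : S) (N : ℕ) :
    B x (μ N) = ∑ p ∈ antidiagonal N, N.choose p.1 • (B x (κ p.1) * μ p.2) := by
  have h1 : B x 1 = 0 := by
    have h := hder x 1 1
    rw [mul_one, mul_one, one_mul] at h
    have h' : B x 1 + B x 1 = B x 1 + 0 := by rw [add_zero]; exact h.symm
    exact add_left_cancel h'
  induction N using Nat.strong_induction_on with
  | _ N ih =>
  rcases N with _ | n
  · rw [hμ0, h1, Finset.Nat.antidiagonal_zero, sum_singleton, hκ0, map_zero, zero_mul, smul_zero]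
  · have hih : ∀ p ∈ antidiagonal n,
        B x (μ p.2) = ∑ q ∈ antidiagonal p.2, p.2.choose q.1 • (B x (κ q.1) * μ q.2) :=
      fun p hp => ih p.2 (by have := HasAntidiagonal.mem_antidiagonal.1 hp; omega)
    have hsecond : ∑ p ∈ antidiagonal n, n.choose p.1 • (κ (p.1 + 1) * B x (μ p.2)) =
        ∑ p ∈ antidiagonal n, n.choose p.1 • (B x (κ p.1) * μ (p.2 + 1)) := by
      calc ∑ p ∈ antidiagonal n, n.choose p.1 • (κ (p.1 + 1) * B x (μ p.2))
          = ∑ p ∈ antidiagonal n, ∑ q ∈ antidiagonal p.2,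
              (n.choose p.1 * p.2.choose q.1) • (κ (p.1 + 1) * (B x (κ q.1) * μ q.2)) := by
            refine sum_congr rfl fun p hp => ?_
            rw [hih p hp, Finset.mul_sum, Finset.smul_sum]
            exact sum_congr rfl fun q _ => by rw [mul_smul_comm, smul_smul]
        _ = ∑ p ∈ antidiagonal n, ∑ q ∈ antidiagonal p.2,
              (n.choose p.1 * p.2.choose q.1) • (κ (q.1 + 1) * (B x (κ p.1) * μ q.2)) :=
            sum_antidiagonal_choose_middle (fun k a b => κ (k + 1) * (B x (κ a) * μ b)) n
        _ = ∑ p ∈ antidiagonal n, n.choose p.1 • (B x (κ p.1) * μ (p.2 + 1)) := by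
            refine sum_congr rfl fun p _ => ?_
            rw [hrec p.2, Finset.mul_sum, Finset.smul_sum]
            exact sum_congr rfl fun q _ => by rw [mul_smul_comm, smul_smul, mul_left_comm]
    have hsplit : ∑ p ∈ antidiagonal (n + 1), (n + 1).choose p.1 • (B x (κ p.1) * μ p.2) =
        ∑ p ∈ antidiagonal n, n.choose p.1 • (B x (κ (p.1 + 1)) * μ p.2) +
          ∑ p ∈ antidiagonal n, n.choose (p.1 + 1) • (B x (κ (p.1 + 1)) * μ p.2) := by
      rw [Finset.Nat.sum_antidiagonal_succ, hκ0, map_zero, zero_mul, smul_zero, zero_add, ← sum_add_distrib]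
      exact sum_congr rfl fun p _ => by rw [Nat.choose_succ_succ', add_smul]
    have hbdry : ∑ p ∈ antidiagonal n, n.choose (p.1 + 1) • (B x (κ (p.1 + 1)) * μ p.2) =
        ∑ p ∈ antidiagonal n, n.choose p.1 • (B x (κ p.1) * μ (p.2 + 1)) := by
      have e1 := Finset.Nat.sum_antidiagonal_succ (n := n) (f := fun p => n.choose p.1 • (B x (κ p.1) * μ p.2))
      have e2 := Finset.Nat.sum_antidiagonal_succ' (n := n) (f := fun p => n.choose p.1 • (B x (κ p.1) * μ p.2))
      dsimp only at e1 e2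
      rw [hκ0, map_zero, zero_mul, smul_zero, zero_add] at e1
      rw [Nat.choose_succ_self, zero_smul, zero_add] at e2
      rw [← e1, e2]
    rw [hrec n, map_sum]
    simp only [map_nsmul, hder, smul_add, sum_add_distrib]
    rw [hsecond, hsplit, hbdry]

/-- **The moment–cumulant recursion against a symmetric biderivation** (the coefficient form of
`𝒫(K', M) = ½ (d/dX 𝒫(K,K)) · M` for `M = exp K`): with `Q₂(N) = Σ_{a+b=N} C(N,a) B(κ_a, κ_b)`,
`2 Σ_{k+m=n} C(n,k) B(κ_{k+1}, μ_m) = Σ_{k+m=n} C(n,k) Q₂(k+1) μ_m`. [folklore] -/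
private theorem two_smul_sum_pairing_cumulant_moment (B : S → S →+ S)
    (hder : ∀ x y z, B x (y * z) = B x y * z + y * B x z) (hsym : ∀ x y, B x y = B y x)
    (μ κ : ℕ → S) (hμ0 : μ 0 = 1) (hκ0 : κ 0 = 0)
    (hrec : ∀ n, μ (n + 1) = ∑ p ∈ antidiagonal n, n.choose p.1 • (κ (p.1 + 1) * μ p.2)) (n : ℕ) :
    2 • ∑ p ∈ antidiagonal n, n.choose p.1 • B (κ (p.1 + 1)) (μ p.2) =
      ∑ p ∈ antidiagonal n, n.choose p.1 •
        ((∑ q ∈ antidiagonal (p.1 + 1), (p.1 + 1).choose q.1 • B (κ q.1) (κ q.2)) * μ p.2) := by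
  -- the symmetrisation `2 Σ_{k+a=j} C(j,k) B(κ_{k+1}, κ_a) = Q₂(j+1)`
  have hstar : ∀ j, 2 • ∑ q ∈ antidiagonal j, j.choose q.1 • B (κ (q.1 + 1)) (κ q.2) =
      ∑ q ∈ antidiagonal (j + 1), (j + 1).choose q.1 • B (κ q.1) (κ q.2) := by
    intro j
    have e1 := Finset.Nat.sum_antidiagonal_succ (n := j) (f := fun q => j.choose q.1 • B (κ q.1) (κ q.2))
    have e2 := Finset.Nat.sum_antidiagonal_succ' (n := j) (f := fun q => j.choose q.1 • B (κ q.1) (κ q.2))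
    dsimp only at e1 e2
    rw [hκ0, hsym 0, map_zero, smul_zero, zero_add] at e1
    rw [Nat.choose_succ_self, zero_smul, zero_add] at e2
    have hsw : ∑ q ∈ antidiagonal j, j.choose q.1 • B (κ q.1) (κ (q.2 + 1)) =
        ∑ q ∈ antidiagonal j, j.choose q.1 • B (κ (q.1 + 1)) (κ q.2) := by
      rw [← Finset.Nat.sum_antidiagonal_swap]
      refine sum_congr rfl fun q hq => ?_
      rw [Prod.fst_swap, Prod.snd_swap, hsym (κ q.2),
        ← Nat.choose_symm_of_eq_add (HasAntidiagonal.mem_antidiagonal.1 hq).symm]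
    rw [Finset.Nat.sum_antidiagonal_succ, hκ0, hsym 0, map_zero, smul_zero, zero_add]
    simp only [Nat.choose_succ_succ', add_smul, sum_add_distrib]
    rw [← e1, e2, hsw, two_nsmul]
  have hD := map_moment_eq_sum_of_derivation B hder μ κ hμ0 hκ0 hrec
  calc 2 • ∑ p ∈ antidiagonal n, n.choose p.1 • B (κ (p.1 + 1)) (μ p.2)
      = 2 • ∑ p ∈ antidiagonal n, ∑ q ∈ antidiagonal p.2,
          (n.choose p.1 * p.2.choose q.1) • (B (κ (p.1 + 1)) (κ q.1) * μ q.2) := by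
        congr 1
        refine sum_congr rfl fun p _ => ?_
        rw [hD, Finset.smul_sum]
        exact sum_congr rfl fun q _ => by rw [smul_smul]
    _ = 2 • ∑ p ∈ antidiagonal n, ∑ q ∈ antidiagonal p.1,
          (n.choose p.1 * p.1.choose q.1) • (B (κ (q.1 + 1)) (κ q.2) * μ p.2) := by
        rw [sum_antidiagonal_choose_assoc (fun k a b => B (κ (k + 1)) (κ a) * μ b) n]
    _ = 2 • ∑ p ∈ antidiagonal n, n.choose p.1 •
          ((∑ q ∈ antidiagonal p.1, p.1.choose q.1 • B (κ (q.1 + 1)) (κ q.2)) * μ p.2) := by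
        congr 1
        refine sum_congr rfl fun p _ => ?_
        rw [Finset.sum_mul, Finset.smul_sum]
        exact sum_congr rfl fun q _ => by rw [smul_mul_assoc, smul_smul]
    _ = ∑ p ∈ antidiagonal n, n.choose p.1 •
          ((∑ q ∈ antidiagonal (p.1 + 1), (p.1 + 1).choose q.1 • B (κ q.1) (κ q.2)) * μ p.2) := by
        rw [Finset.smul_sum]
        refine sum_congr rfl fun p _ => ?_
        rw [smul_comm (2 : ℕ) (n.choose p.1), ← smul_mul_assoc, hstar]

/-- Boundary reduction: a sum over `a + b = N` whose terms vanish when `a = 0` or `b = 0` is the sum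
over `1 ≤ a ≤ N - 1`. [folklore] -/
private theorem sum_antidiagonal_eq_sum_Icc {M : Type*} [AddCommMonoid M] (f : ℕ → ℕ → M) (N : ℕ)
    (h0 : ∀ b, f 0 b = 0) (h0' : ∀ a, f a 0 = 0) :
    ∑ p ∈ antidiagonal N, f p.1 p.2 = ∑ a ∈ Icc 1 (N - 1), f a (N - a) := by
  rw [← Finset.sum_filter_add_sum_filter_not (antidiagonal N) (fun p => p.1 ≠ 0 ∧ p.2 ≠ 0),
    Finset.sum_eq_zero (s := (antidiagonal N).filter fun p => ¬(p.1 ≠ 0 ∧ p.2 ≠ 0)) (fun p hp => by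
      obtain ⟨-, hp⟩ := mem_filter.1 hp
      rcases not_and_or.1 hp with h | h
      · rw [not_not.1 h, h0]
      · rw [not_not.1 h, h0']), add_zero]
  symm
  refine sum_nbij' (fun a => (a, N - a)) (fun p => p.1) ?_ ?_ ?_ ?_ ?_
  · intro a ha
    simp only [mem_Icc] at ha
    simp only [mem_filter, HasAntidiagonal.mem_antidiagonal]
    omega
  · intro p hp
    simp only [mem_filter, HasAntidiagonal.mem_antidiagonal] at hp
    simp only [mem_Icc]
    omega
  · intro a _
    rfl
  · intro p hp
    simp only [mem_filter, HasAntidiagonal.mem_antidiagonal] at hp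
    ext
    · rfl
    · dsimp only; omega
  · intro a _
    rfl

end CumulantAlgebra

/-! ## §3 The order-by-order flow of the moments and cumulants of `e^{Δ_{C_t}}` -/

section Flow

variable {𝕂 : Type*} [NontriviallyNormedField 𝕂] {𝕜 : Type*} [RCLike 𝕜] [NormedAlgebra 𝕂 𝕜]
variable {Γ : Type*} [LinearOrder Γ] [Fintype Γ]

open GrassmannAlgebra.HasCoeffDerivAt Literature.Probability.LatticeModels

/-- **The moments flow by the Laplacian**: `∂_t e^{Δ_{C_t}} x = Δ_{Ċ} e^{Δ_{C_t}} x` on the even part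
(Salmhofer's (Geffdif) `∂_t e^{𝒢} = Δ̇ e^{𝒢}`, for any even `x` in place of `e^{𝒢(0,ψ)}`).
[cite: Salmhofer1998, §3.1 Prop. 1 (Geffdif) with proof (render p0011:L73-L76, L128-L131)] -/
theorem hasCoeffDerivAt_coe_evenGaussConv {C : 𝕂 → Matrix Γ Γ 𝕜} {C' : Matrix Γ Γ 𝕜} {t : 𝕂}
    (hC : ∀ X Y, HasDerivAt (fun r => C r X Y) (C' X Y) t) (x : evenPart 𝕜 Γ) :
    HasCoeffDerivAt (fun r => ((evenGaussConv 𝕜 (C r) x : evenPart 𝕜 Γ) : GrassmannAlgebra 𝕜 Γ))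
      (grassmannLaplacian 𝕜 C' ((evenGaussConv 𝕜 (C t) x : evenPart 𝕜 Γ) : GrassmannAlgebra 𝕜 Γ)) t := by
  simp only [coe_evenGaussConv]
  exact hasCoeffDerivAt_gaussConv_apply hC _

/-- **Order-by-order renormalization group flow of the truncated expectations.**  Let `t ↦ C_t` be
entrywise differentiable at `t` with antisymmetric derivative `Ċ = C'`, `W` even, `μ_k(r) = e^{Δ_{C_r}} W^k`
the moments and `κ_N(r)` (`κ_0 = 0`, `κ_N = cumulantOf μ(r) N` for `N ≥ 1`) the cumulants = truncated
expectations `𝓔ᵀ_{C_r}(W; N)`.  Then, coefficientwise,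
`∂_t κ_N = Δ_{Ċ} κ_N + ½ Σ_{a+b=N} C(N,a) (δκ_a/δψ, Ċ δκ_b/δψ)` — Salmhofer's (RGE) at order `λ^r`
for `𝒢_r = κ_r/r!` (binomial form), here derived from the moment flow `∂_t μ_k = Δ_{Ċ} μ_k` ((Geffdif)) and the
moment–cumulant recursion by induction on `N` (the tree's substitute for "comparing the coefficients of
`λ^r` in (RGE)"). [cite: Salmhofer1998, §3.1-3.2, (RGE) at order λ^r (render p0011:L46-L60, L143-L150; p0012:L38-L54)] -/
theorem hasCoeffDerivAt_cumulant_flow {C : 𝕂 → Matrix Γ Γ 𝕜} {C' : Matrix Γ Γ 𝕜} {t : 𝕂}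
    (hC : ∀ X Y, HasDerivAt (fun r => C r X Y) (C' X Y) t) (hC' : C'.transpose = -C')
    (W : evenPart 𝕜 Γ) (μ κ : 𝕂 → ℕ → evenPart 𝕜 Γ) (hμ : ∀ r k, μ r k = evenGaussConv 𝕜 (C r) (W ^ k))
    (hκ0 : ∀ r, κ r 0 = 0) (hκ : ∀ r N, N ≠ 0 → κ r N = cumulantOf (μ r) N) (N : ℕ) :
    HasCoeffDerivAt (fun r => ((κ r N : evenPart 𝕜 Γ) : GrassmannAlgebra 𝕜 Γ))
      (grassmannLaplacian 𝕜 C' (κ t N : GrassmannAlgebra 𝕜 Γ) +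
        (2 : 𝕜)⁻¹ • ∑ p ∈ antidiagonal N, (N.choose p.1 : 𝕜) •
          grassmannDerivPairing 𝕜 C' (κ t p.1 : GrassmannAlgebra 𝕜 Γ) (κ t p.2 : GrassmannAlgebra 𝕜 Γ)) t := by
  -- the moment flow
  have hM : ∀ k, HasCoeffDerivAt (fun r => ((μ r k : evenPart 𝕜 Γ) : GrassmannAlgebra 𝕜 Γ))
      (grassmannLaplacian 𝕜 C' (μ t k : GrassmannAlgebra 𝕜 Γ)) t := fun k => by
    have h := hasCoeffDerivAt_coe_evenGaussConv hC (W ^ k)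
    simp only [← hμ] at h
    exact h
  -- the recursion in `⋀^{even}`
  have hμ0 : ∀ r, μ r 0 = 1 := fun r =>
    Subtype.ext (by rw [hμ, pow_zero, coe_evenGaussConv, OneMemClass.coe_one, gaussConv_one])
  have hrec : ∀ r n, μ r (n + 1) = ∑ p ∈ antidiagonal n, n.choose p.1 • (κ r (p.1 + 1) * μ r p.2) := by
    intro r n
    rw [moment_succ_eq_sum_choose_mul_cumulantOf (μ r) (hμ0 r) n, Finset.Nat.sum_antidiagonal_eq_sum_range_succ_mk]
    refine sum_congr rfl fun k _ => ?_
    rw [hκ r (k + 1) (Nat.succ_ne_zero k), nsmul_eq_mul, mul_assoc]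
  -- the algebraic identity of §2, in `⋀^{even}` and coerced to the Grassmann algebra
  set A := GrassmannAlgebra 𝕜 Γ
  set B : evenPart 𝕜 Γ → evenPart 𝕜 Γ →+ evenPart 𝕜 Γ := fun x => AddMonoidHom.mk'
    (fun y => ⟨grassmannDerivPairing 𝕜 C' (x : A) (y : A), grassmannDerivPairing_mem_evenOdd_zero 𝕜 C' x.2 y.2⟩)
    (fun y z => Subtype.ext (grassmannDerivPairing_add_right 𝕜 C' _ _ _)) with hB
  have hBcoe : ∀ x y, ((B x y : evenPart 𝕜 Γ) : A) = grassmannDerivPairing 𝕜 C' (x : A) (y : A) := fun _ _ => rfl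
  have hder : ∀ x y z, B x (y * z) = B x y * z + y * B x z := fun x y z => Subtype.ext (by
    rw [hBcoe, MulMemClass.coe_mul, AddMemClass.coe_add, MulMemClass.coe_mul, MulMemClass.coe_mul, hBcoe, hBcoe]
    exact grassmannDerivPairing_mul_right_of_mem_evenOdd_zero 𝕜 C' _ y.2 _)
  have hsym : ∀ x y, B x y = B y x := fun x y =>
    Subtype.ext (grassmannDerivPairing_comm_of_mem_evenOdd_zero 𝕜 C' hC' x.2 y.2)
  have hAM : ∀ n, (2 : 𝕜) • ∑ p ∈ antidiagonal n, (n.choose p.1 : 𝕜) •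
      grassmannDerivPairing 𝕜 C' (κ t (p.1 + 1) : A) (μ t p.2 : A) =
      ∑ p ∈ antidiagonal n, (n.choose p.1 : 𝕜) •
        ((∑ q ∈ antidiagonal (p.1 + 1), ((p.1 + 1).choose q.1 : 𝕜) •
          grassmannDerivPairing 𝕜 C' (κ t q.1 : A) (κ t q.2 : A)) * (μ t p.2 : A)) := by
    intro n
    have h := congrArg (evenPart 𝕜 Γ).val
      (two_smul_sum_pairing_cumulant_moment B hder hsym (μ t) (κ t) (hμ0 t) (hκ0 t) (hrec t) n)
    simp only [map_nsmul, map_sum, map_mul, Subalgebra.coe_val] at h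
    simp only [hBcoe, ← Nat.cast_smul_eq_nsmul 𝕜, Nat.cast_ofNat] at h
    exact h
  -- induction on `N`
  induction N using Nat.strong_induction_on with
  | _ N ih =>
  rcases N with _ | n
  · simp only [hκ0, ZeroMemClass.coe_zero, map_zero, Finset.Nat.antidiagonal_zero, sum_singleton,
      grassmannDerivPairing_zero_left, smul_zero, add_zero]
    exact hasCoeffDerivAt_const 0 t
  · -- `κ_{n+1} = μ_{n+1} - Σ_{k+m=n, m ≥ 1} C(n,k) κ_{k+1} μ_m`
    obtain ⟨E', hE'⟩ : ∃ E' : Finset (ℕ × ℕ), E' = (antidiagonal n).erase (n, 0) := ⟨_, rfl⟩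
    have hmemE : (n, 0) ∈ antidiagonal n := by simp [HasAntidiagonal.mem_antidiagonal]
    have hfun : ∀ r, ((κ r (n + 1) : evenPart 𝕜 Γ) : A) =
        (μ r (n + 1) : A) - ∑ p ∈ E', (n.choose p.1 : 𝕜) • ((κ r (p.1 + 1) : A) * (μ r p.2 : A)) := by
      intro r
      have h := hrec r n
      rw [← Finset.add_sum_erase _ _ hmemE, Nat.choose_self, one_smul, hμ0, mul_one, ← hE'] at h
      have h' := congrArg (evenPart 𝕜 Γ).val h
      simp only [map_nsmul, map_sum, map_mul, map_add, Subalgebra.coe_val] at h'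
      simp only [← Nat.cast_smul_eq_nsmul 𝕜] at h'
      rw [h', add_sub_cancel_right]
    have hlt : ∀ p ∈ E', p.1 + 1 < n + 1 := fun p hp => by
      rw [hE'] at hp
      obtain ⟨hne, hp⟩ := Finset.mem_erase.1 hp
      rw [HasAntidiagonal.mem_antidiagonal] at hp
      have : p.2 ≠ 0 := fun h2 => hne (Prod.ext (by simp at hp ⊢; omega) h2)
      omega
    have hF : (fun r => ((κ r (n + 1) : evenPart 𝕜 Γ) : A)) = fun r =>
        (μ r (n + 1) : A) - ∑ p ∈ E', (n.choose p.1 : 𝕜) • ((κ r (p.1 + 1) : A) * (μ r p.2 : A)) := funext hfun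
    rw [hF]
    refine ((hM (n + 1)).sub (HasCoeffDerivAt.sum E'
      (X := fun p r => (n.choose p.1 : 𝕜) • ((κ r (p.1 + 1) : A) * (μ r p.2 : A)))
      fun p hp => ((ih (p.1 + 1) (hlt p hp)).mul (hM p.2)).const_smul (n.choose p.1 : 𝕜))).congr_deriv ?_
    -- the Laplacian of `κ_{n+1}` by the Leibniz defect
    have hΔ : grassmannLaplacian 𝕜 C' (κ t (n + 1) : A) = grassmannLaplacian 𝕜 C' (μ t (n + 1) : A) -
        ∑ p ∈ E', (n.choose p.1 : 𝕜) • (grassmannLaplacian 𝕜 C' (κ t (p.1 + 1) : A) * (μ t p.2 : A) +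
          (κ t (p.1 + 1) : A) * grassmannLaplacian 𝕜 C' (μ t p.2 : A) +
          grassmannDerivPairing 𝕜 C' (κ t (p.1 + 1) : A) (μ t p.2 : A)) := by
      rw [hfun t, map_sub, map_sum]
      congr 1
      refine sum_congr rfl fun p _ => ?_
      rw [map_smul, grassmannLaplacian_mul_of_mem_evenOdd_zero 𝕜 C' hC' (κ t (p.1 + 1)).2]
    -- the `(n, 0)` terms of the identity of §2
    have hP0 : grassmannDerivPairing 𝕜 C' (κ t (n + 1) : A) (μ t 0 : A) = 0 := by
      rw [hμ0, OneMemClass.coe_one, grassmannDerivPairing_one_right]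
    have hAM' : ∑ p ∈ E', (n.choose p.1 : 𝕜) • grassmannDerivPairing 𝕜 C' (κ t (p.1 + 1) : A) (μ t p.2 : A) =
        (2 : 𝕜)⁻¹ • ∑ p ∈ E', (n.choose p.1 : 𝕜) •
          ((∑ q ∈ antidiagonal (p.1 + 1), ((p.1 + 1).choose q.1 : 𝕜) •
            grassmannDerivPairing 𝕜 C' (κ t q.1 : A) (κ t q.2 : A)) * (μ t p.2 : A)) +
        (2 : 𝕜)⁻¹ • ∑ q ∈ antidiagonal (n + 1), ((n + 1).choose q.1 : 𝕜) •
            grassmannDerivPairing 𝕜 C' (κ t q.1 : A) (κ t q.2 : A) := by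
      have h := hAM n
      rw [← Finset.add_sum_erase _ _ hmemE, ← Finset.add_sum_erase (antidiagonal n) _ hmemE, Nat.choose_self,
        Nat.cast_one, one_smul, one_smul, hP0, zero_add, hμ0, OneMemClass.coe_one, mul_one, ← hE'] at h
      dsimp only at h
      have h2 : (2 : 𝕜) ≠ 0 := two_ne_zero
      rw [← smul_add, add_comm, ← h, smul_smul, inv_mul_cancel₀ h2, one_smul]
    rw [hΔ]
    simp only [smul_add, add_mul, sum_add_distrib]
    rw [hAM']
    simp only [smul_mul_assoc]
    simp only [Finset.smul_sum, smul_comm (_ : 𝕜) ((2 : 𝕜)⁻¹)]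
    abel

/-- **Salmhofer's renormalization group equation at order `λ^r` for the perturbative effective action.**
With `𝒢_r(s) = (r!)⁻¹ κ_r(s)` for `r ≥ 1` and `𝒢_0 = 0`, where `κ_r(s) = 𝓔ᵀ_{C_s}(W; r) =
cumulantOf (k ↦ e^{Δ_{C_s}} W^k) r` are the truncated expectations of the even interaction `W` — `𝒢_r` is
the coefficient of `λ^r` in `𝒢(s,ψ) = log e^{Δ_{C_s}} e^{λ W(ψ)}` (p0011:L46-L53, L143-L150; `e^{Δ_C} e^{λW} = Σ_k λ^k μ_k/k! =
exp Σ_r λ^r κ_r/r!` is the exponential formula `egf_eq_exp_subst_egfPos_cumulantOf`; in the tree's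
normalised form the field-dependent part is `-effAction`, `kernel_effAction_eq_neg_tsum`) — one has,
coefficientwise in the finite Grassmann algebra,
`∂_t 𝒢_r = Δ_{Ċ} 𝒢_r + ½ Σ_{r₁=1}^{r-1} (δ𝒢_{r₁}/δψ, Ċ δ𝒢_{r-r₁}/δψ)_Γ`
for an entrywise differentiable covariance with antisymmetric derivative `Ċ = C'` at `t` (in the print:
"comparison of the coefficients" of `λ^r` in (RGE), p0012:L38-L54, L108; here: `hasCoeffDerivAt_cumulant_flow`).
[cite: Salmhofer1998, §3.1-3.2, (RGE) at order λ^r (render p0011:L46-L60, L143-L150; p0012:L38-L54)] -/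
theorem hasCoeffDerivAt_orderwise_effAction {C : 𝕂 → Matrix Γ Γ 𝕜} {C' : Matrix Γ Γ 𝕜} {t : 𝕂}
    (hC : ∀ X Y, HasDerivAt (fun r => C r X Y) (C' X Y) t) (hC' : C'.transpose = -C')
    (W : evenPart 𝕜 Γ) (𝒢 : ℕ → 𝕂 → GrassmannAlgebra 𝕜 Γ)
    (h𝒢 : ∀ r s, 𝒢 r s = if r = 0 then 0 else ((r ! : 𝕜)⁻¹) •
      ((cumulantOf (fun k => evenGaussConv 𝕜 (C s) (W ^ k)) r : evenPart 𝕜 Γ) : GrassmannAlgebra 𝕜 Γ))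
    (r : ℕ) :
    HasCoeffDerivAt (𝒢 r) (grassmannLaplacian 𝕜 C' (𝒢 r t) +
      (2 : 𝕜)⁻¹ • ∑ r₁ ∈ Icc 1 (r - 1), grassmannDerivPairing 𝕜 C' (𝒢 r₁ t) (𝒢 (r - r₁) t)) t := by
  set μ : 𝕂 → ℕ → evenPart 𝕜 Γ := fun s k => evenGaussConv 𝕜 (C s) (W ^ k) with hμ
  set κ : 𝕂 → ℕ → evenPart 𝕜 Γ := fun s N => if N = 0 then 0 else cumulantOf (μ s) N with hκ
  have hκ0 : ∀ s, κ s 0 = 0 := fun s => by rw [hκ]; exact if_pos rfl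
  have hflow := hasCoeffDerivAt_cumulant_flow hC hC' W μ κ (fun _ _ => rfl) hκ0
    (fun s N hN => by rw [hκ]; exact if_neg hN) r
  have h𝒢κ : ∀ r s, 𝒢 r s = ((r ! : 𝕜)⁻¹) • (κ s r : GrassmannAlgebra 𝕜 Γ) := by
    intro r s
    rw [h𝒢, hκ]
    rcases eq_or_ne r 0 with hr | hr
    · rw [if_pos hr]
      dsimp only
      rw [if_pos hr, ZeroMemClass.coe_zero, smul_zero]
    · rw [if_neg hr]
      dsimp only
      rw [if_neg hr]
  have hP : ∀ p ∈ antidiagonal r, ((r ! : 𝕜)⁻¹) • ((r.choose p.1 : 𝕜) •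
      grassmannDerivPairing 𝕜 C' (κ t p.1 : GrassmannAlgebra 𝕜 Γ) (κ t p.2 : GrassmannAlgebra 𝕜 Γ)) =
      grassmannDerivPairing 𝕜 C' (𝒢 p.1 t) (𝒢 p.2 t) := by
    intro p hp
    have hpr : p.1 + p.2 = r := HasAntidiagonal.mem_antidiagonal.1 hp
    rw [h𝒢κ p.1 t, h𝒢κ p.2 t, grassmannDerivPairing_smul_left, grassmannDerivPairing_smul_right, smul_smul,
      smul_smul]
    congr 1
    have h1 : (p.1 ! : 𝕜) ≠ 0 := Nat.cast_ne_zero.2 (Nat.factorial_ne_zero _)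
    have h2 : (p.2 ! : 𝕜) ≠ 0 := Nat.cast_ne_zero.2 (Nat.factorial_ne_zero _)
    have hfac : (r ! : 𝕜) = (r.choose p.1 : 𝕜) * (p.1 ! : 𝕜) * (p.2 ! : 𝕜) := by
      rw [← hpr, Nat.choose_symm_add]
      exact_mod_cast (Nat.add_choose_mul_factorial_mul_factorial p.1 p.2).symm
    have hC0 : (r.choose p.1 : 𝕜) ≠ 0 := by
      intro h0
      rw [h0, zero_mul, zero_mul] at hfac
      exact Nat.cast_ne_zero.2 (Nat.factorial_ne_zero r) hfac
    rw [hfac]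
    field_simp
  refine ((hflow.const_smul ((r ! : 𝕜)⁻¹)).congr_of_eventuallyEq
    (Filter.Eventually.of_forall (h𝒢κ r))).congr_deriv ?_
  rw [smul_add, ← map_smul, ← h𝒢κ, smul_comm, Finset.smul_sum, Finset.sum_congr rfl hP,
    sum_antidiagonal_eq_sum_Icc (fun a b => grassmannDerivPairing 𝕜 C' (𝒢 a t) (𝒢 b t)) r
      (fun b => by rw [h𝒢 0, if_pos rfl, grassmannDerivPairing_zero_left])
      (fun a => by rw [h𝒢 0, if_pos rfl, grassmannDerivPairing_zero_right])]


end Flow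

end Literature.MathematicalPhysics.QuantumLattice
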